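import Summits.AtomisticToContinuum.Crystallization.Theorems.ChartedZeroExcessLayeredLatticeLiouvilleZZZYG

/-!
# ChartedZeroExcess · LayeredLatticeLiouville ZZZYH (lens-2 g92 RIDER 92b «ExitByMotion») — SOFT CORES LEAVE THE TUBE ONLY BY A LOCAL RIGID MOTION,
# AND THE SPLIT SCALE OF RECORD (Rd, τ⋆) = (121/25, 249/10000).
Docket `stmt-AtomisticToContinuum-26636` (crux `ChartedZeroExcessLayered`), W2 line; critic r1630 (B): energetic residual of record (OGᴹ′) `OffTubeGapMinP`,
ONE EQUIV layer `offTubeGapMinP_iff_softHard : (OGᴹ′) ↔ (OGˢ′)(Rd, τ) ∧ (OGʰ′)(Rd, τ)` (tree ZZZYG), with the CONDITION that the split scale be registered as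
ONE pair.  THIS FILE (all PROVED, 0 sorry, def-free) is the typed anchor of that registration:
* `exit_by_motion_of_soft` — THE KINEMATICS OF THE SOFT CLASS: if the core `xf` is soft about an INNER-tube filling `y` (pair range `Rd ≥ Rg`, tolerance `τ`,
  proper rotation `V i` per site) and lies OFF the OUTER tube `bondTube X Rg sb dI dB y₀`, then EITHER some star is ROTATED — an `Rg`-pair with
  `‖V i (y j − y i) − (y j − y i)‖ > sb − sb₁ − τ` — OR some site is DISPLACED from the minimiser by `> dI − dI₁` (an interface site) or `> dB − dB₁` (bulk).
  A soft core never exits by strain: the three exits are rigid motions of a star / a site, which is exactly why (OGˢ′) is a BENDING statement.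
* `exit_by_motion_record` — the instance at the record radii `Rg = Rd = 121/25`, `sb = dI = 249/5000`, `dB = 21/50`, inner radii `4·sb₁ ≤ sb`, and the
  REGISTERED tolerance `τ⋆ = 249/10000 = sb/2`: the exit-forcing rotation defect is `> 249/20000 = sb/4` on a pair of length `≤ 121/25 + sb₁`, i.e. an angle
  `≳ 2.5·10⁻³ rad`; the trade-off fixing `τ⋆` (soft wants `τ` small: this margin is `sb − sb₁ − τ`; hard wants `τ` large: the defect amplitude `τ` must dominate
  the minimiser's own label slack `sb₁ ≤ sb/4`) balances at `τ⋆ = sb/2`, where both margins are `≥ sb/4`.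
* `offTubeGapMinP_iff_softHard_record` / `mildCoherentMoatCorePG_W2g_record` — the EQUIV layer and the door W2g written at the registered pair, so that the two
  leaves OF RECORD are the closed terms (OGˢ′⋆) `OffTubeSoftGapMinP …(record dials)… (121/25) (249/10000) g₀` and (OGʰ′⋆) `OffTubeHardGapMinP … (121/25) (249/10000) g₀`.
0 sorry · import = ZZZYG only · def-free · no instances/notation/options · axioms standard. [g92b]
-/

noncomputable section
open scoped BigOperators Classical InnerProductSpace RealInnerProductSpace
open MeasureTheory Set Metric Filter Topology

namespace Summit.AtomisticToContinuum.Crystallization.Theorems.ChartedZeroExcessLayeredLatticeLiouville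

open Summit.AtomisticToContinuum.Crystallization.Theorems.ChartedPlanarOrderRigidityDoor (E3 IsClean)

section ExitByMotion

variable {n : ℕ}

/-- ★ **SOFT CORES LEAVE THE TUBE ONLY BY A LOCAL RIGID MOTION.**  `y` in the inner tube (radii `sb₁ dI₁ dB₁`), `xf` off the outer tube (radii `sb dI dB`),
and `xf` co-rotated with `y` up to `τ` on every pair of reference length `≤ Rd` (`Rg ≤ Rd`) by the proper field `V` ⟹ a star ROTATION
`‖V i (y j − y i) − (y j − y i)‖ > sb − sb₁ − τ` on an `Rg`-pair, or an interface-site DISPLACEMENT `dist (xf i) (y i) > dI − dI₁`, or a bulk one `> dB − dB₁`.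
(Pure kinematics: three triangle inequalities against `mem_bondTube_iff`.) [g92b] -/
theorem exit_by_motion_of_soft {X : Set E3} {Rg Rd τ sb dI dB sb₁ dI₁ dB₁ : ℝ} {y₀ y xf : Fin n → E3} (hRd : Rg ≤ Rd)
    (hy : y ∈ bondTube X Rg sb₁ dI₁ dB₁ y₀) (hoff : xf ∉ bondTube X Rg sb dI dB y₀) {V : Fin n → (E3 ≃ₗᵢ[ℝ] E3)}
    (hV : ∀ i j, dist (y₀ i) (y₀ j) ≤ Rd → ‖(xf j - xf i) - V i (y j - y i)‖ ≤ τ) :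
    (∃ i j, dist (y₀ i) (y₀ j) ≤ Rg ∧ sb - sb₁ - τ < ‖V i (y j - y i) - (y j - y i)‖) ∨
      (∃ i, (∃ p ∈ X, dist (y₀ i) p ≤ Rg) ∧ dI - dI₁ < dist (xf i) (y i)) ∨ (∃ i, dB - dB₁ < dist (xf i) (y i)) := by
  rw [mem_bondTube_iff] at hy
  obtain ⟨hyb, hyI, hyB⟩ := hy
  by_contra hcon
  simp only [not_or, not_exists, not_and, not_lt] at hcon
  obtain ⟨h1, h2, h3⟩ := hcon
  apply hoff
  rw [mem_bondTube_iff]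
  refine ⟨fun i j hij => ?_, fun i hi => ?_, fun i => ?_⟩
  · have hs : ‖(xf j - xf i) - V i (y j - y i)‖ ≤ τ := hV i j (hij.trans hRd)
    have hr : ‖V i (y j - y i) - (y j - y i)‖ ≤ sb - sb₁ - τ := h1 i j hij
    have hyij : ‖(y i - y j) - (y₀ i - y₀ j)‖ ≤ sb₁ := by rw [← dist_eq_norm]; exact hyb i j hij
    rw [dist_eq_norm]
    have key : (xf i - xf j) - (y₀ i - y₀ j) =
        -((xf j - xf i) - V i (y j - y i)) - (V i (y j - y i) - (y j - y i)) + ((y i - y j) - (y₀ i - y₀ j)) := by abel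
    rw [key]
    calc ‖-((xf j - xf i) - V i (y j - y i)) - (V i (y j - y i) - (y j - y i)) + ((y i - y j) - (y₀ i - y₀ j))‖
        ≤ ‖-((xf j - xf i) - V i (y j - y i)) - (V i (y j - y i) - (y j - y i))‖ + ‖(y i - y j) - (y₀ i - y₀ j)‖ := norm_add_le _ _
      _ ≤ (‖-((xf j - xf i) - V i (y j - y i))‖ + ‖V i (y j - y i) - (y j - y i)‖) + ‖(y i - y j) - (y₀ i - y₀ j)‖ := by
          gcongr; exact norm_sub_le _ _
      _ ≤ (τ + (sb - sb₁ - τ)) + sb₁ := by rw [norm_neg]; gcongr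
      _ = sb := by ring
  · calc dist (xf i) (y₀ i) ≤ dist (xf i) (y i) + dist (y i) (y₀ i) := dist_triangle _ _ _
      _ ≤ (dI - dI₁) + dI₁ := add_le_add (h2 i hi) (hyI i hi)
      _ = dI := by ring
  · calc dist (xf i) (y₀ i) ≤ dist (xf i) (y i) + dist (y i) (y₀ i) := dist_triangle _ _ _
      _ ≤ (dB - dB₁) + dB₁ := add_le_add (h3 i) (hyB i)
      _ = dB := by ring

/-- the same, from the soft CLASS `IsSoftAbout Rd τ y₀ y xf` (the proper field is produced, with its `det = 1` certificate). [g92b] -/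
theorem exit_by_motion_of_isSoftAbout {X : Set E3} {Rg Rd τ sb dI dB sb₁ dI₁ dB₁ : ℝ} {y₀ y xf : Fin n → E3} (hRd : Rg ≤ Rd)
    (hy : y ∈ bondTube X Rg sb₁ dI₁ dB₁ y₀) (hoff : xf ∉ bondTube X Rg sb dI dB y₀) (hsoft : IsSoftAbout Rd τ y₀ y xf) :
    ∃ V : Fin n → (E3 ≃ₗᵢ[ℝ] E3), (∀ i, LinearMap.det ((V i).toLinearEquiv : E3 →ₗ[ℝ] E3) = 1) ∧
      (∀ i j, dist (y₀ i) (y₀ j) ≤ Rd → ‖(xf j - xf i) - V i (y j - y i)‖ ≤ τ) ∧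
      ((∃ i j, dist (y₀ i) (y₀ j) ≤ Rg ∧ sb - sb₁ - τ < ‖V i (y j - y i) - (y j - y i)‖) ∨
        (∃ i, (∃ p ∈ X, dist (y₀ i) p ≤ Rg) ∧ dI - dI₁ < dist (xf i) (y i)) ∨ (∃ i, dB - dB₁ < dist (xf i) (y i))) := by
  obtain ⟨V, hdet, hV⟩ := hsoft
  exact ⟨V, hdet, hV, exit_by_motion_of_soft hRd hy hoff hV⟩

/-- ★ **THE INSTANCE AT THE RECORD RADII AND THE REGISTERED SPLIT SCALE `(Rd, τ⋆) = (121/25, 249/10000)`**: `Rg = Rd = 121/25`, outer radii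
`sb = dI = 249/5000`, `dB = 21/50`, inner radii with `4·sb₁ ≤ 249/5000`, `4·dI₁ ≤ 249/5000`, `dB₁ ≤ 2/5`, tolerance `τ⋆ = sb/2`: a soft off-tube core has a star
rotated by `> 249/20000 = sb/4` on a pair, or an interface site displaced by `> 747/20000`, or a bulk site displaced by `> 1/50`, relative to the minimiser. [g92b] -/
theorem exit_by_motion_record {X : Set E3} {sb₁ dI₁ dB₁ : ℝ} {y₀ y xf : Fin n → E3} (hsb : 4 * sb₁ ≤ 249 / 5000) (hdI : 4 * dI₁ ≤ 249 / 5000)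
    (hdB : dB₁ ≤ 2 / 5) (hy : y ∈ bondTube X (121 / 25) sb₁ dI₁ dB₁ y₀) (hoff : xf ∉ bondTube X (121 / 25) (249 / 5000) (249 / 5000) (21 / 50) y₀)
    (hsoft : IsSoftAbout (121 / 25) (249 / 10000) y₀ y xf) :
    ∃ V : Fin n → (E3 ≃ₗᵢ[ℝ] E3), (∀ i, LinearMap.det ((V i).toLinearEquiv : E3 →ₗ[ℝ] E3) = 1) ∧
      (∀ i j, dist (y₀ i) (y₀ j) ≤ 121 / 25 → ‖(xf j - xf i) - V i (y j - y i)‖ ≤ 249 / 10000) ∧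
      ((∃ i j, dist (y₀ i) (y₀ j) ≤ 121 / 25 ∧ 249 / 20000 < ‖V i (y j - y i) - (y j - y i)‖) ∨
        (∃ i, (∃ p ∈ X, dist (y₀ i) p ≤ 121 / 25) ∧ 747 / 20000 < dist (xf i) (y i)) ∨ (∃ i, 1 / 50 < dist (xf i) (y i))) := by
  obtain ⟨V, hdet, hV, h⟩ := exit_by_motion_of_isSoftAbout le_rfl hy hoff hsoft
  refine ⟨V, hdet, hV, ?_⟩
  rcases h with ⟨i, j, hij, hr⟩ | ⟨i, hi, hd⟩ | ⟨i, hd⟩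
  · exact Or.inl ⟨i, j, hij, lt_of_le_of_lt (by linarith) hr⟩
  · exact Or.inr (Or.inl ⟨i, hi, lt_of_le_of_lt (by linarith) hd⟩)
  · exact Or.inr (Or.inr ⟨i, lt_of_le_of_lt (by linarith) hd⟩)

/-- the length of a rotated pair at the record radii: an `Rg`-pair of an inner-tube filling has length `≤ 121/25 + sb₁` — so the record rotation defect
`> 249/20000` of `exit_by_motion_record` is an ANGULAR defect `> (249/20000)/(121/25 + sb₁)` of the star rotation `V i` (operator-norm reading). [g92b] -/
theorem pair_norm_le_of_mem_bondTube {X : Set E3} {Rg sb₁ dI₁ dB₁ : ℝ} {y₀ y : Fin n → E3} (hy : y ∈ bondTube X Rg sb₁ dI₁ dB₁ y₀) {i j : Fin n}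
    (hij : dist (y₀ i) (y₀ j) ≤ Rg) : ‖y j - y i‖ ≤ Rg + sb₁ := by
  have hb : ‖(y i - y j) - (y₀ i - y₀ j)‖ ≤ sb₁ := by rw [← dist_eq_norm]; exact (mem_bondTube_iff.1 hy).1 i j hij
  have h0 : ‖y₀ i - y₀ j‖ ≤ Rg := by rwa [← dist_eq_norm]
  calc ‖y j - y i‖ = ‖(y₀ i - y₀ j) + ((y i - y j) - (y₀ i - y₀ j))‖ := by rw [← norm_neg (y j - y i)]; congr 1; abel
    _ ≤ ‖y₀ i - y₀ j‖ + ‖(y i - y j) - (y₀ i - y₀ j)‖ := norm_add_le _ _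
    _ ≤ Rg + sb₁ := add_le_add h0 hb

end ExitByMotion

section Record

variable {n : ℕ}

/-- ★ **THE EQUIV LAYER AT THE REGISTERED PAIR `(Rd, τ⋆) = (121/25, 249/10000)`** (record dials, any `ϑc`, `σ`, inner radii, `g₀`):
(OGᴹ′) ↔ (OGˢ′⋆) ∧ (OGʰ′⋆). [g92b] -/
theorem offTubeGapMinP_iff_softHard_record {ϑc σ sb₁ dI₁ dB₁ g₀ : ℝ} :
    OffTubeGapMinP ϑc tameRadius (1 / 10) 8 (145 / 16) 4 12 16 16 σ (1 / 10000) 5 (1 / 10000) 10 (43 / 2) (121 / 25) (249 / 5000) (249 / 5000)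
        (21 / 50) sb₁ dI₁ dB₁ g₀ 1 2 (1 / 16) (1 / 50) ↔
      OffTubeSoftGapMinP ϑc tameRadius (1 / 10) 8 (145 / 16) 4 12 16 16 σ (1 / 10000) 5 (1 / 10000) 10 (43 / 2) (121 / 25) (249 / 5000) (249 / 5000)
          (21 / 50) sb₁ dI₁ dB₁ (121 / 25) (249 / 10000) g₀ 1 2 (1 / 16) (1 / 50) ∧
        OffTubeHardGapMinP ϑc tameRadius (1 / 10) 8 (145 / 16) 4 12 16 16 σ (1 / 10000) 5 (1 / 10000) 10 (43 / 2) (121 / 25) (249 / 5000) (249 / 5000)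
          (21 / 50) sb₁ dI₁ dB₁ (121 / 25) (249 / 10000) g₀ 1 2 (1 / 16) (1 / 50) :=
  offTubeGapMinP_iff_softHard

/-- ★ **THE DOOR W2g AT THE REGISTERED PAIR**: `ϑc ≤ 5·10⁻¹²`, (X1ᴸ′)(lam > 0), (X2ᴸ′), and the two leaves OF RECORD (OGˢ′⋆), (OGʰ′⋆) with a common
`g₀ > 0` ⟹ `[MCMC♮](ϑc)`. [g92b] -/
theorem mildCoherentMoatCorePG_W2g_record {ϑc sb₁ dI₁ dB₁ lam g₀ : ℝ} (hϑc : ϑc ≤ 1 / 200000000000) (hlam : 0 < lam) (hg₀ : 0 < g₀)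
    (hsb : 4 * sb₁ ≤ 249 / 5000) (hdI : 4 * dI₁ ≤ 249 / 5000) (hdB : dB₁ ≤ 2 / 5) (hsb₀ : 0 ≤ sb₁) (hdI₀ : 0 ≤ dI₁) (hdB₀ : 0 ≤ dB₁)
    (hX1 : LabelTubeConvexityP ϑc tameRadius (1 / 10) 8 (145 / 16) 4 12 16 16 (27 / 32) (1 / 10000) 5 (1 / 10000) 10 (43 / 2) (1 / 5000) (121 / 25)
      (249 / 5000) (249 / 5000) (21 / 50) lam 1 2 (1 / 16) (1 / 50))
    (hX2 : LabelLoadedTubeAprioriP ϑc tameRadius (1 / 10) 8 (145 / 16) 4 12 16 16 (27 / 32) (1 / 10000) 5 (1 / 10000) 10 (43 / 2) (1 / 5000)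
      (121 / 25) (249 / 5000) (249 / 5000) (21 / 50) sb₁ dI₁ dB₁ 1 2 (1 / 16) (1 / 50))
    (hS : OffTubeSoftGapMinP ϑc tameRadius (1 / 10) 8 (145 / 16) 4 12 16 16 (27 / 32) (1 / 10000) 5 (1 / 10000) 10 (43 / 2) (121 / 25) (249 / 5000)
      (249 / 5000) (21 / 50) sb₁ dI₁ dB₁ (121 / 25) (249 / 10000) g₀ 1 2 (1 / 16) (1 / 50))
    (hH : OffTubeHardGapMinP ϑc tameRadius (1 / 10) 8 (145 / 16) 4 12 16 16 (27 / 32) (1 / 10000) 5 (1 / 10000) 10 (43 / 2) (121 / 25) (249 / 5000)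
      (249 / 5000) (21 / 50) sb₁ dI₁ dB₁ (121 / 25) (249 / 10000) g₀ 1 2 (1 / 16) (1 / 50)) :
    MildCoherentMoatCorePG ϑc tameRadius (1 / 10) 8 4 12 16 1 2 (1 / 16) (1 / 50) :=
  mildCoherentMoatCorePG_W2g_softHard hϑc hlam hg₀ hsb hdI hdB hsb₀ hdI₀ hdB₀ hX1 hX2 hS hH

end Record

end Summit.AtomisticToContinuum.Crystallization.Theorems.ChartedZeroExcessLayeredLatticeLiouville
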